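import Summits.Ventures.HSemireg.WedgeHankelRecurrenceGaussSecularEquation

/-!
# Venture HSemireg — **KY FAN ∕ SCHUR BOUNDS FOR CONTIGUOUS BLOCKS OF THE RECURRENCE**: for `r₀ + r' ≤ t` the partial diagonal sum `a_{r₀} + ⋯ + a_{r₀+r'}` lies between the sum of the `r' + 1`
# SMALLEST and the sum of the `r' + 1` LARGEST zeros of `q_{t+1}`: `Σ_{m≤r'} x_m ≤ Σ_{n≤r'} a_{r₀+n} ≤ Σ_{m≤r'} x_{m+t−r'}` — in particular `a_i + a_{i+1} ≤ x_{t−1} + x_t` and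
# `x_0 + x_1 ≤ a_i + a_{i+1}` for every `i < t` (N329 is the case `r' = 0`, the trace identity N298 the case `r' = t`)

HONEST FRAMING. Part of the Lean index of the computation cell `pub-hsemireg` (seat p10 gen 45, Sunday typer «UNIFORM-IN-n»).  Real polynomials and finite sums only; no variety, no cohomology
theory, no sheaf, no Ext group and no semiregularity map is constructed here; nothing here says that HC / HC_CM / HC_AV holds; no Literature fact (unproved `Prop`) is declared or used.  Custodian
versions as in `WedgeHankelSiegelIdeal` (1/3).
SOURCES (cited).  I. Schur, *Über eine Klasse von Mittelbildungen mit Anwendungen auf die Determinantentheorie*, S.-B. Berlin. Math. Ges. 22 (1923) 9–20 (the diagonal is majorised by the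
eigenvalues); Ky Fan, Proc. Nat. Acad. Sci. USA 35 (1949) 652–655; R. A. Horn, C. R. Johnson, *Matrix Analysis* (2nd ed.) Thm 4.3.45 ∕ Cor. 4.3.39; for Jacobi matrices via interlacing:
B. N. Parlett, *The Symmetric Eigenvalue Problem* (1980) §10.1.
PROOF TYPED HERE.  The zeros `θ` of the block polynomial `Q_{r'+1}` (order-`r₀` associated recurrence) exist (N279) and sum to `Σ a_{r₀+n}` (N298 `sum_recurrence_zeros`); N356's Cauchy interlacing
`x_m ≤ θ_m ≤ x_{m+t−r'}` is summed over `m`.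
DEDUP DISCLOSURE (`rg -n 'schur|ky_fan|majoris|block_diagonal_sum' Summits/Ventures/HSemireg`, 2026-09-03): N329 `diag_mem_Icc_extreme_zeros` (one entry), N298 (full trace); the partial sums
are new.  The 3 names below: 0 hits tree-wide.

WHAT IS IN THE TREE.  N279 `recurrence_zeros_interlace` (existence of the zero vector); N298 `sum_recurrence_zeros`; N356 `associated_block_interlace_lower` ∕ `_upper`.
THIS FILE (namespace `Summit.Ventures.HSemireg.Wedge.HankelOuter` continued; CHAINED on N357 (import only); 0 definitions):
* §1123 **`block_diagonal_sum_le_top_zeros`** (`Σ_{n≤r'} a_{r₀+n} ≤ Σ_{m≤r'} x_{m+t−r'}`), **`bottom_zeros_le_block_diagonal_sum`** (`Σ_{m≤r'} x_m ≤ Σ_{n≤r'} a_{r₀+n}`),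
  `two_diagonal_le_top_two_zeros` (`a_i + a_{i+1} ≤ x_{t−1} + x_t` and `x_0 + x_1 ≤ a_i + a_{i+1}`, `i < t`).
CAVEATS.  Positive recurrences; contiguous blocks only.  Nothing Ext-side.  New names only.
-/

open Module Polynomial
open scoped Matrix Polynomial

namespace Summit.Ventures.HSemireg.Wedge.HankelOuter

/-! ## §1123. Schur–Ky Fan bounds for contiguous blocks -/

/-- **`Σ_{n≤r'} a_{r₀+n} ≤ Σ_{m≤r'} x_{m+t−r'}`: a partial diagonal sum is at most the sum of as many largest zeros.** [Schur 1923; Ky Fan 1949; Horn–Johnson Thm 4.3.45; this file, §1123] -/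
theorem block_diagonal_sum_le_top_zeros {q : ℕ → ℝ[X]} {a b : ℕ → ℝ} (hq0 : q 0 = 1) (hq1 : q 1 = Polynomial.X - C (a 0))
    (hrec : ∀ n, q (n + 2) = (Polynomial.X - C (a (n + 1))) * q (n + 1) - C (b (n + 1)) * q n) (hb : ∀ j, 0 < b j) {r₀ t r' : ℕ} (hr : r₀ + r' ≤ t)
    {x : Fin (t + 1) → ℝ} (hx : StrictMono x) (hxq : q (t + 1) = ∏ j, (Polynomial.X - C (x j))) :
    ∑ n ∈ Finset.range (r' + 1), a (r₀ + n) ≤ ∑ m : Fin (r' + 1), x ⟨m + (t - r'), by omega⟩ := by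
  -- the associated recurrence of order `r₀` and the zeros of its `(r'+1)`-st member
  obtain ⟨Q, A, B, hQ0, hQ1, hQrec, hA, hB⟩ : ∃ (Q : ℕ → ℝ[X]) (A B : ℕ → ℝ), Q 0 = 1 ∧ Q 1 = Polynomial.X - C (A 0) ∧
      (∀ n, Q (n + 2) = (Polynomial.X - C (A (n + 1))) * Q (n + 1) - C (B (n + 1)) * Q n) ∧ (∀ n, A n = a (n + r₀)) ∧ ∀ n, B n = b (n + r₀) := by
    refine ⟨fun n => Nat.rec (motive := fun _ => ℝ[X] × ℝ[X]) (1, Polynomial.X - C (a (0 + r₀)))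
      (fun n p => (p.2, (Polynomial.X - C (a (n + 1 + r₀))) * p.2 - C (b (n + 1 + r₀)) * p.1)) n |>.1, fun n => a (n + r₀), fun n => b (n + r₀), rfl, rfl, fun n => ?_, fun n => rfl, fun n => rfl⟩
    rfl
  have hB' : ∀ j, 0 < B j := fun j => by rw [hB]; exact hb _
  obtain ⟨θ, -, hθ, -, hθq, -, -⟩ := recurrence_zeros_interlace hQ0 hQ1 hQrec hB' r'
  have hsum : ∑ m, θ m = ∑ n ∈ Finset.range (r' + 1), A n := sum_recurrence_zeros hQ0 hQ1 hQrec hθq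
  rw [show ∑ n ∈ Finset.range (r' + 1), a (r₀ + n) = ∑ n ∈ Finset.range (r' + 1), A n from Finset.sum_congr rfl fun n _ => by rw [hA, add_comm], ← hsum]
  exact Finset.sum_le_sum fun m _ => associated_block_interlace_upper hq0 hq1 hrec hQ0 hQ1 hQrec hb hA hB hr hx hxq hθ hθq m

/-- **`Σ_{m≤r'} x_m ≤ Σ_{n≤r'} a_{r₀+n}`: a partial diagonal sum is at least the sum of as many smallest zeros.** [Schur 1923; Ky Fan 1949; this file, §1123] -/
theorem bottom_zeros_le_block_diagonal_sum {q : ℕ → ℝ[X]} {a b : ℕ → ℝ} (hq0 : q 0 = 1) (hq1 : q 1 = Polynomial.X - C (a 0))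
    (hrec : ∀ n, q (n + 2) = (Polynomial.X - C (a (n + 1))) * q (n + 1) - C (b (n + 1)) * q n) (hb : ∀ j, 0 < b j) {r₀ t r' : ℕ} (hr : r₀ + r' ≤ t)
    {x : Fin (t + 1) → ℝ} (hx : StrictMono x) (hxq : q (t + 1) = ∏ j, (Polynomial.X - C (x j))) :
    ∑ m : Fin (r' + 1), x ⟨m, by omega⟩ ≤ ∑ n ∈ Finset.range (r' + 1), a (r₀ + n) := by
  obtain ⟨Q, A, B, hQ0, hQ1, hQrec, hA, hB⟩ : ∃ (Q : ℕ → ℝ[X]) (A B : ℕ → ℝ), Q 0 = 1 ∧ Q 1 = Polynomial.X - C (A 0) ∧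
      (∀ n, Q (n + 2) = (Polynomial.X - C (A (n + 1))) * Q (n + 1) - C (B (n + 1)) * Q n) ∧ (∀ n, A n = a (n + r₀)) ∧ ∀ n, B n = b (n + r₀) := by
    refine ⟨fun n => Nat.rec (motive := fun _ => ℝ[X] × ℝ[X]) (1, Polynomial.X - C (a (0 + r₀)))
      (fun n p => (p.2, (Polynomial.X - C (a (n + 1 + r₀))) * p.2 - C (b (n + 1 + r₀)) * p.1)) n |>.1, fun n => a (n + r₀), fun n => b (n + r₀), rfl, rfl, fun n => ?_, fun n => rfl, fun n => rfl⟩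
    rfl
  have hB' : ∀ j, 0 < B j := fun j => by rw [hB]; exact hb _
  obtain ⟨θ, -, hθ, -, hθq, -, -⟩ := recurrence_zeros_interlace hQ0 hQ1 hQrec hB' r'
  have hsum : ∑ m, θ m = ∑ n ∈ Finset.range (r' + 1), A n := sum_recurrence_zeros hQ0 hQ1 hQrec hθq
  rw [show ∑ n ∈ Finset.range (r' + 1), a (r₀ + n) = ∑ n ∈ Finset.range (r' + 1), A n from Finset.sum_congr rfl fun n _ => by rw [hA, add_comm], ← hsum]
  exact Finset.sum_le_sum fun m _ => associated_block_interlace_lower hq0 hq1 hrec hQ0 hQ1 hQrec hb hA hB hr hx hxq hθ hθq m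

/-- **Two consecutive diagonal coefficients: `a_i + a_{i+1} ≤ x_{t−1} + x_t` and `x_0 + x_1 ≤ a_i + a_{i+1}`** (`i < t`). [Schur 1923; this file, §1123] -/
theorem two_diagonal_le_top_two_zeros {q : ℕ → ℝ[X]} {a b : ℕ → ℝ} (hq0 : q 0 = 1) (hq1 : q 1 = Polynomial.X - C (a 0))
    (hrec : ∀ n, q (n + 2) = (Polynomial.X - C (a (n + 1))) * q (n + 1) - C (b (n + 1)) * q n) (hb : ∀ j, 0 < b j) {t i : ℕ} (hit : i < t)
    {x : Fin (t + 1) → ℝ} (hx : StrictMono x) (hxq : q (t + 1) = ∏ j, (Polynomial.X - C (x j))) :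
    a i + a (i + 1) ≤ x ⟨t - 1, by omega⟩ + x (Fin.last t) ∧ x 0 + x ⟨1, by omega⟩ ≤ a i + a (i + 1) := by
  have h1 := block_diagonal_sum_le_top_zeros hq0 hq1 hrec hb (r₀ := i) (r' := 1) (by omega) hx hxq
  have h2 := bottom_zeros_le_block_diagonal_sum hq0 hq1 hrec hb (r₀ := i) (r' := 1) (by omega) hx hxq
  rw [Finset.sum_range_succ, Finset.sum_range_one, add_zero, Fin.sum_univ_two] at h1 h2
  refine ⟨h1.trans_eq ?_, le_trans (le_of_eq ?_) h2⟩
  · congr 1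
    · exact congrArg x (Fin.ext (by simp))
    · exact congrArg x (Fin.ext (by simp; omega))
  · congr 1

end Summit.Ventures.HSemireg.Wedge.HankelOuter
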